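import Mathlib.Analysis.InnerProductSpace.PiL2
import Literature.Geometry.DiscreteGeometry.TwoShellIntegerModel
import Literature.Geometry.DiscreteGeometry.TwoShellChartCheck

/-!
# Local charts of two-shell-good configurations — the REAL SEMANTICS of the certificate checker

Topic `Literature/Geometry/DiscreteGeometry`; companion of `TwoShellChartCheck.lean`.  This file fixes what the integer
data of the checker MEAN for a real configuration and proves the dictionary between the `√18` integer model
(`TwoShellCheck.IVec`, triples) and the patterns `fccTwoShellPattern` / `hcpTwoShellPattern` of `TwoShellPatterns.lean`:

* `pt z = z/√18` (the model point of a triple), its additivity and `‖pt z‖² = TwoShellCheck.sq z / 18`, `‖pt z − pt z'‖² = TwoShellCheck.sq (z − z')/18`;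
* `pt` carries `modelList t` ONTO the pattern of type `t` (`pt_mem_pattern`, `exists_pt_eq_of_mem_pattern`), injectively;
  pattern points have norm `1` or `√2`, the first shell being `TwoShellCheck.sq = 18`;
* the real-side predicates consumed by the soundness proofs of the chart step: a PIVOT WITNESS `PivotW` (pattern type,
  frame `B` scaling norms by `ρ ∈ [47/50, 50/47]`, assignment of pattern labels to particles) and its goodness
  `PivotGood` (the clauses of `IsTwoShellGood` transported to the centre's normalised frame), the centre's goodness
  `CentreGood`, the particle of a common (`commonParticle`), the ERROR BOUND of a placement entry
  (`EntryBound y (P, d, num) : ‖y − P/d‖ ≤ num/(940|d|)`) and the description of a pivot's particles by a placement table up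
  to order (`TableDescribes`).
No named fact is introduced; everything is [folklore] bookkeeping.

## References
* T. C. Hales, *Dense Sphere Packings: a blueprint for formal proofs* (2012), §1.3. [HalesDSP2012]
* J. H. Conway, N. J. A. Sloane, *Sphere Packings, Lattices and Groups*, 3rd ed. (1999), Ch. 4 §6.3. [ConwaySloane1999]
-/

noncomputable section

namespace Literature.Geometry.DiscreteGeometry.TwoShellChart

open TwoShellCheck
open scoped BigOperators

/-! ### The model point of a triple -/

/-- The model point `z/√18` of an integer triple. [folklore] -/
def pt (z : IVec) : EuclideanSpace ℝ (Fin 3) := (Real.sqrt 18)⁻¹ • intVec (IVec.toFun z)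

/-- Coordinates of the integer vector of a triple. [folklore] -/
theorem toFun_apply (z : IVec) : IVec.toFun z 0 = z.1 ∧ IVec.toFun z 1 = z.2.1 ∧ IVec.toFun z 2 = z.2.2 := by
  simp [IVec.toFun]

/-- `toFun` of a sum. [folklore] -/
theorem toFun_vadd (a b : IVec) : IVec.toFun (vadd a b) = IVec.toFun a + IVec.toFun b := by
  funext i; fin_cases i <;> simp [IVec.toFun, vadd]

/-- `toFun` of a difference. [folklore] -/
theorem toFun_vsub (a b : IVec) : IVec.toFun (vsub a b) = IVec.toFun a - IVec.toFun b := by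
  funext i; fin_cases i <;> simp [IVec.toFun, vsub]

/-- `toFun` of a multiple. [folklore] -/
theorem toFun_vsmul (k : ℤ) (a : IVec) : IVec.toFun (vsmul k a) = k • IVec.toFun a := by
  funext i; fin_cases i <;> simp [IVec.toFun, vsmul]

/-- `sqNormInt` of the vector of a triple is `sq`. [folklore] -/
theorem sqNormInt_toFun (z : IVec) : sqNormInt (IVec.toFun z) = TwoShellCheck.sq z := by
  simp [sqNormInt, IVec.toFun, TwoShellCheck.sq, pow_two]

/-- `pt` is additive. [folklore] -/
theorem pt_vadd (a b : IVec) : pt (vadd a b) = pt a + pt b := by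
  have h : ∀ v w : Fin 3 → ℤ, intVec (v + w) = intVec v + intVec w := fun v w => by ext i; simp [intVec]
  simp only [pt, toFun_vadd, h, smul_add]

/-- `pt` of a difference. [folklore] -/
theorem pt_vsub (a b : IVec) : pt (vsub a b) = pt a - pt b := by
  simp only [pt, toFun_vsub, ← intVec_sub, smul_sub]

/-- `pt` of a multiple. [folklore] -/
theorem pt_vsmul (k : ℤ) (a : IVec) : pt (vsmul k a) = (k : ℝ) • pt a := by
  have h : ∀ (k : ℤ) (v : Fin 3 → ℤ), intVec (k • v) = (k : ℝ) • intVec v := fun k v => by ext i; simp [intVec]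
  simp only [pt, toFun_vsmul, h, smul_comm (k : ℝ)]

/-- `pt 0 = 0`. [folklore] -/
@[simp] theorem pt_zero : pt ((0 : ℤ), (0 : ℤ), (0 : ℤ)) = 0 := by
  have : intVec (IVec.toFun ((0 : ℤ), (0 : ℤ), (0 : ℤ))) = 0 := by
    ext i; fin_cases i <;> simp [intVec, IVec.toFun]
  simp [pt, this]

/-- `‖pt z‖² = TwoShellCheck.sq z / 18`. [folklore] -/
theorem norm_pt_sq (z : IVec) : ‖pt z‖ ^ 2 = (TwoShellCheck.sq z : ℝ) / 18 := by
  rw [pt, norm_sq_intVec_div, sqNormInt_toFun]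

/-- `‖pt z − pt z'‖² = TwoShellCheck.sq (z − z') / 18`. [folklore] -/
theorem norm_pt_sub_sq (z z' : IVec) : ‖pt z - pt z'‖ ^ 2 = (TwoShellCheck.sq (vsub z z') : ℝ) / 18 := by
  rw [← pt_vsub, norm_pt_sq]

/-- `sq` is non-negative. [folklore] -/
theorem sq_nonneg' (z : IVec) : 0 ≤ TwoShellCheck.sq z := by
  unfold TwoShellCheck.sq; nlinarith [sq_nonneg z.1, sq_nonneg z.2.1, sq_nonneg z.2.2]

/-- `‖pt z‖ = 1 ↔ TwoShellCheck.sq z = 18`. [folklore] -/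
theorem norm_pt_eq_one_iff (z : IVec) : ‖pt z‖ = 1 ↔ TwoShellCheck.sq z = 18 := by
  have h := norm_pt_sq z
  constructor
  · intro h1
    rw [h1, one_pow] at h
    have : (TwoShellCheck.sq z : ℝ) = 18 := by linarith
    exact_mod_cast this
  · intro h18
    rw [h18] at h
    norm_num at h
    have h0 : 0 ≤ ‖pt z‖ := norm_nonneg _
    rcases h with h | h
    · exact h
    · linarith

/-- `pt` is injective. [folklore] -/
theorem pt_injective : Function.Injective pt := by
  intro z z' h
  have h0 : ‖pt z - pt z'‖ ^ 2 = 0 := by rw [h, sub_self, norm_zero]; ring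
  rw [norm_pt_sub_sq] at h0
  have h1 : TwoShellCheck.sq (vsub z z') = 0 := by exact_mod_cast (by linarith : (TwoShellCheck.sq (vsub z z') : ℝ) = 0)
  obtain ⟨a, b, c⟩ := z
  obtain ⟨a', b', c'⟩ := z'
  simp only [TwoShellCheck.sq, vsub] at h1
  have ha : a - a' = 0 := by nlinarith [_root_.sq_nonneg (a - a'), _root_.sq_nonneg (b - b'), _root_.sq_nonneg (c - c')]
  have hb : b - b' = 0 := by nlinarith [_root_.sq_nonneg (a - a'), _root_.sq_nonneg (b - b'), _root_.sq_nonneg (c - c')]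
  have hc : c - c' = 0 := by nlinarith [_root_.sq_nonneg (a - a'), _root_.sq_nonneg (b - b'), _root_.sq_nonneg (c - c')]
  simp only [Prod.mk.injEq]
  exact ⟨by omega, by omega, by omega⟩

/-! ### The model lists are the patterns -/

/-- The pattern of a type. [folklore] -/
def patternOf (t : Bool) : Finset (EuclideanSpace ℝ (Fin 3)) := if t then hcpTwoShellPattern else fccTwoShellPattern

/-- `patternOf t` is one of the two patterns. [folklore] -/
theorem patternOf_eq_or (t : Bool) : patternOf t = fccTwoShellPattern ∨ patternOf t = hcpTwoShellPattern := by
  cases t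
  · exact Or.inl rfl
  · exact Or.inr rfl

/-- Integer bookkeeping: the fcc list is the fcc integer model. [folklore] -/
theorem toFun_mem_fccModelInt : ∀ z ∈ fccList, IVec.toFun z ∈ fccModelInt := by decide

/-- Integer bookkeeping: the hcp list is the hcp integer model. [folklore] -/
theorem toFun_mem_hcpModelInt : ∀ z ∈ hcpList, IVec.toFun z ∈ hcpModelInt := by decide

/-- Integer bookkeeping, converse (fcc). [folklore] -/
theorem mem_fccList_of_mem_fccModelInt : ∀ f ∈ fccModelInt, (f 0, f 1, f 2) ∈ fccList := by decide

/-- Integer bookkeeping, converse (hcp). [folklore] -/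
theorem mem_hcpList_of_mem_hcpModelInt : ∀ f ∈ hcpModelInt, (f 0, f 1, f 2) ∈ hcpList := by decide

/-- **`pt` maps the model list into the pattern.** [folklore] -/
theorem pt_mem_pattern {t : Bool} {z : IVec} (hz : z ∈ modelList t) : pt z ∈ patternOf t := by
  cases t
  · simp only [modelList, Bool.false_eq_true, ↓reduceIte] at hz
    show pt z ∈ fccTwoShellPattern
    rw [fccTwoShellPattern_eq_image, show Real.sqrt ((18 : ℕ) : ℝ) = Real.sqrt 18 by norm_num]
    exact Finset.mem_image_of_mem _ (toFun_mem_fccModelInt z hz)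
  · simp only [modelList, ↓reduceIte] at hz
    show pt z ∈ hcpTwoShellPattern
    rw [hcpTwoShellPattern_eq_image, show Real.sqrt ((18 : ℕ) : ℝ) = Real.sqrt 18 by norm_num]
    exact Finset.mem_image_of_mem _ (toFun_mem_hcpModelInt z hz)

/-- The triple of an integer vector has that vector as its `toFun`. [folklore] -/
theorem toFun_mk (f : Fin 3 → ℤ) : IVec.toFun (f 0, f 1, f 2) = f := by
  funext i; fin_cases i <;> simp [IVec.toFun]

/-- **Every pattern point is `pt` of a point of the model list.** [folklore] -/
theorem exists_pt_eq_of_mem_pattern {t : Bool} {v : EuclideanSpace ℝ (Fin 3)} (hv : v ∈ patternOf t) :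
    ∃ z ∈ modelList t, pt z = v := by
  cases t
  · change v ∈ fccTwoShellPattern at hv
    rw [fccTwoShellPattern_eq_image, show Real.sqrt ((18 : ℕ) : ℝ) = Real.sqrt 18 by norm_num] at hv
    obtain ⟨f, hf, rfl⟩ := Finset.mem_image.1 hv
    exact ⟨(f 0, f 1, f 2), mem_fccList_of_mem_fccModelInt f hf, by rw [pt, toFun_mk]⟩
  · change v ∈ hcpTwoShellPattern at hv
    rw [hcpTwoShellPattern_eq_image, show Real.sqrt ((18 : ℕ) : ℝ) = Real.sqrt 18 by norm_num] at hv
    obtain ⟨f, hf, rfl⟩ := Finset.mem_image.1 hv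
    exact ⟨(f 0, f 1, f 2), mem_hcpList_of_mem_hcpModelInt f hf, by rw [pt, toFun_mk]⟩

/-- Pattern points of the model list have norm `1` or `√2`. [folklore] -/
theorem norm_pt_of_mem {t : Bool} {z : IVec} (hz : z ∈ modelList t) : ‖pt z‖ = 1 ∨ ‖pt z‖ = Real.sqrt 2 := by
  have h := pt_mem_pattern hz
  cases t
  · exact norm_of_mem_fccTwoShellPattern h
  · exact norm_of_mem_hcpTwoShellPattern h

/-- The model lists have no duplicates. [folklore] -/
theorem nodup_modelList (t : Bool) : (modelList t).Nodup := by cases t <;> decide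

/-- The model lists have eighteen points. [folklore] -/
theorem length_modelList (t : Bool) : (modelList t).length = 18 := by cases t <;> decide

/-- Membership in the commons of a pivot. [folklore] -/
theorem mem_commonsOf {cen : List IVec} {v c : IVec} :
    c ∈ commonsOf cen v ↔ (c = ((0 : ℤ), (0 : ℤ), (0 : ℤ)) ∨ c ∈ cen) ∧ TwoShellCheck.sq (vsub c v) = 18 := by
  simp [commonsOf, beq_iff_eq]

/-! ### Real-side predicates -/

/-- A PIVOT WITNESS over the particle type `ι`: pattern type, frame (a linear map scaling all norms by `ρ`), scale ratio,
and the assignment of the pattern's labels to particles. [folklore] -/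
structure PivotW (ι : Type*) where
  /-- pattern type (`true` = hcp) -/
  t : Bool
  /-- the pivot's frame seen in the centre's normalised frame -/
  B : EuclideanSpace ℝ (Fin 3) →ₗ[ℝ] EuclideanSpace ℝ (Fin 3)
  /-- the scale ratio `a'/a` -/
  ρ : ℝ
  /-- label ↦ particle -/
  fP : IVec → ι

/-- **Goodness of a pivot witness** at the particle `j` (the clauses of `IsTwoShellGood`, normalised): `B` scales norms by
`ρ ∈ [47/50, 50/47]`; every label's particle is not `j` and sits within `ρ/20` of `pos j + B (pt w)`; the assignment is
injective on the pattern; and every particle other than `j` within `3ρ/2` of `pos j` is assigned. [folklore] -/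
def PivotGood {ι : Type*} (pos : ι → EuclideanSpace ℝ (Fin 3)) (j : ι) (W : PivotW ι) : Prop :=
  (∀ z, ‖W.B z‖ = W.ρ * ‖z‖) ∧ 47 / 50 ≤ W.ρ ∧ W.ρ ≤ 50 / 47 ∧
  (∀ w ∈ modelList W.t, W.fP w ≠ j ∧ ‖pos (W.fP w) - (pos j + W.B (pt w))‖ ≤ W.ρ / 20) ∧
  (∀ w ∈ modelList W.t, ∀ w' ∈ modelList W.t, W.fP w = W.fP w' → w = w') ∧
  (∀ k, k ≠ j → ‖pos k - pos j‖ ≤ 3 / 2 * W.ρ → ∃ w ∈ modelList W.t, W.fP w = k)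

/-- **Goodness of the centre** (normalised): the centre particle `i₀` sits at `0`, the pattern particles `fC c` (`c ∈ cen`)
are not `i₀` and sit within `1/20` of `pt c`, the assignment is injective on `cen`, and every other particle of norm `≤ 3/2`
is assigned. [folklore] -/
def CentreGood {ι : Type*} (cen : List IVec) (pos : ι → EuclideanSpace ℝ (Fin 3)) (i₀ : ι) (fC : IVec → ι) : Prop :=
  pos i₀ = 0 ∧ (∀ c ∈ cen, fC c ≠ i₀ ∧ ‖pos (fC c) - pt c‖ ≤ 1 / 20) ∧
  (∀ c ∈ cen, ∀ c' ∈ cen, fC c = fC c' → c = c') ∧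
  (∀ k, k ≠ i₀ → ‖pos k‖ ≤ 3 / 2 → ∃ c ∈ cen, fC c = k)

/-- The particle of a common: the centre for `0`, else the centre's pattern particle. [folklore] -/
def commonParticle {ι : Type*} (i₀ : ι) (fC : IVec → ι) (c : IVec) : ι :=
  if c = ((0 : ℤ), (0 : ℤ), (0 : ℤ)) then i₀ else fC c

/-- **Correct labels**: the label list `phi` is aligned with the commons `cs`, each label is a point of the pivot's pattern
and is assigned to the particle of its common. [folklore] -/
def LabelsOK {ι : Type*} (i₀ : ι) (fC : IVec → ι) (W : PivotW ι) (cs phi : List IVec) : Prop :=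
  List.Forall₂ (fun c w => w ∈ modelList W.t ∧ W.fP w = commonParticle i₀ fC c) cs phi

/-- **The error bound of a placement entry**: `d ≠ 0` and `‖y − P/d‖ ≤ num / (940 |d|)`. [folklore] -/
def EntryBound (y : EuclideanSpace ℝ (Fin 3)) (e : Entry) : Prop :=
  e.2.1 ≠ 0 ∧ ‖y - ((e.2.1 : ℝ)⁻¹) • pt e.1‖ ≤ (e.2.2 : ℝ) / (940 * |(e.2.1 : ℝ)|)

/-- **A placement table describes a pivot**: up to order, the table is the list of entries of the eighteen labels, each
bounding its label's particle. [folklore] -/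
def TableDescribes {ι : Type*} (pos : ι → EuclideanSpace ℝ (Fin 3)) (W : PivotW ι) (T : List Entry) : Prop :=
  ∃ eo : IVec → Entry, List.Perm ((modelList W.t).map eo) T ∧ ∀ w ∈ modelList W.t, EntryBound (pos (W.fP w)) (eo w)


/-! ### Pattern symmetries as real maps -/

/-- The coordinate permutation `permApply k` on real vectors. [folklore] -/
def permFun (k : ℕ) (x : EuclideanSpace ℝ (Fin 3)) : EuclideanSpace ℝ (Fin 3) :=
  match k with
  | 0 => x
  | 1 => !₂[x 0, x 2, x 1]
  | 2 => !₂[x 1, x 0, x 2]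
  | 3 => !₂[x 1, x 2, x 0]
  | 4 => !₂[x 2, x 0, x 1]
  | _ => !₂[x 2, x 1, x 0]

/-- The signed permutation `symApply g` on real vectors. [folklore] -/
def symFun (g : ℕ × IVec) (x : EuclideanSpace ℝ (Fin 3)) : EuclideanSpace ℝ (Fin 3) :=
  !₂[(g.2.1 : ℝ) * permFun g.1 x 0, (g.2.2.1 : ℝ) * permFun g.1 x 1, (g.2.2.2 : ℝ) * permFun g.1 x 2]

/-- `permFun` beyond index `4` is the last permutation. [folklore] -/
theorem permFun_of_ge (k : ℕ) (hk : 5 ≤ k) (x : EuclideanSpace ℝ (Fin 3)) : permFun k x = !₂[x 2, x 1, x 0] := by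
  unfold permFun
  split <;> first | rfl | omega

/-- `permApply` beyond index `4` is the last permutation. [folklore] -/
theorem permApply_of_ge (k : ℕ) (hk : 5 ≤ k) (z : IVec) : permApply k z = (z.2.2, z.2.1, z.1) := by
  unfold permApply
  split <;> first | rfl | omega

/-- `permFun` is linear: additive. [folklore] -/
theorem permFun_add (k : ℕ) (x y : EuclideanSpace ℝ (Fin 3)) : permFun k (x + y) = permFun k x + permFun k y := by
  rcases Nat.lt_or_ge k 5 with hk | hk
  · interval_cases k <;> (ext i; fin_cases i <;> simp [permFun])
  · rw [permFun_of_ge k hk, permFun_of_ge k hk, permFun_of_ge k hk]; ext i; fin_cases i <;> simp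

/-- `permFun` is linear: homogeneous. [folklore] -/
theorem permFun_smul (k : ℕ) (c : ℝ) (x : EuclideanSpace ℝ (Fin 3)) : permFun k (c • x) = c • permFun k x := by
  rcases Nat.lt_or_ge k 5 with hk | hk
  · interval_cases k <;> (ext i; fin_cases i <;> simp [permFun])
  · rw [permFun_of_ge k hk, permFun_of_ge k hk]; ext i; fin_cases i <;> simp

/-- **The signed permutation as a linear map.** [folklore] -/
def symLin (g : ℕ × IVec) : EuclideanSpace ℝ (Fin 3) →ₗ[ℝ] EuclideanSpace ℝ (Fin 3) where
  toFun := symFun g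
  map_add' x y := by
    ext i; fin_cases i <;> simp [symFun, permFun_add] <;> ring
  map_smul' c x := by
    ext i; fin_cases i <;> simp [symFun, permFun_smul] <;> ring

/-- `symLin` acts by `symFun`. [folklore] -/
@[simp] theorem symLin_apply (g : ℕ × IVec) (x : EuclideanSpace ℝ (Fin 3)) : symLin g x = symFun g x := rfl

/-- `permFun` on model points is `permApply`. [folklore] -/
theorem permFun_pt (k : ℕ) (z : IVec) : permFun k (pt z) = pt (permApply k z) := by
  rcases Nat.lt_or_ge k 5 with hk | hk
  · interval_cases k <;> (ext i; fin_cases i <;> simp [permFun, permApply, pt, intVec, IVec.toFun])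
  · rw [permFun_of_ge k hk, permApply_of_ge k hk]; ext i; fin_cases i <;> simp [pt, intVec, IVec.toFun]

/-- **`symLin` on model points is `symApply`**: `symLin g (pt z) = pt (symApply g z)`. [folklore] -/
theorem symLin_pt (g : ℕ × IVec) (z : IVec) : symLin g (pt z) = pt (symApply g z) := by
  rw [symLin_apply, symFun, permFun_pt]
  ext i
  fin_cases i <;> simp [symApply, pt, intVec, IVec.toFun] <;> ring

/-- `permFun` preserves the norm. [folklore] -/
theorem norm_permFun (k : ℕ) (x : EuclideanSpace ℝ (Fin 3)) : ‖permFun k x‖ = ‖x‖ := by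
  have h : ‖permFun k x‖ ^ 2 = ‖x‖ ^ 2 := by
    rw [EuclideanSpace.real_norm_sq_eq, EuclideanSpace.real_norm_sq_eq, Fin.sum_univ_three, Fin.sum_univ_three]
    rcases Nat.lt_or_ge k 5 with hk | hk
    · interval_cases k <;> simp [permFun] <;> ring
    · rw [permFun_of_ge k hk]; simp; ring
  have h0 : 0 ≤ ‖permFun k x‖ := norm_nonneg _
  have h0' : 0 ≤ ‖x‖ := norm_nonneg _
  nlinarith

/-- **`symLin` preserves the norm** when the three signs are `±1`. [folklore] -/
theorem norm_symLin {g : ℕ × IVec} (h1 : g.2.1 = 1 ∨ g.2.1 = -1) (h2 : g.2.2.1 = 1 ∨ g.2.2.1 = -1)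
    (h3 : g.2.2.2 = 1 ∨ g.2.2.2 = -1) (x : EuclideanSpace ℝ (Fin 3)) : ‖symLin g x‖ = ‖x‖ := by
  rw [← norm_permFun g.1 x]
  have e1 : ((g.2.1 : ℝ)) ^ 2 = 1 := by rcases h1 with h | h <;> simp [h]
  have e2 : ((g.2.2.1 : ℝ)) ^ 2 = 1 := by rcases h2 with h | h <;> simp [h]
  have e3 : ((g.2.2.2 : ℝ)) ^ 2 = 1 := by rcases h3 with h | h <;> simp [h]
  have h : ‖symLin g x‖ ^ 2 = ‖permFun g.1 x‖ ^ 2 := by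
    rw [EuclideanSpace.real_norm_sq_eq, EuclideanSpace.real_norm_sq_eq, Fin.sum_univ_three, Fin.sum_univ_three]
    simp only [symLin_apply, symFun]
    simp
    linear_combination ((permFun g.1 x).ofLp 0) ^ 2 * e1 + ((permFun g.1 x).ofLp 1) ^ 2 * e2 +
      ((permFun g.1 x).ofLp 2) ^ 2 * e3
  have h0 : 0 ≤ ‖symLin g x‖ := norm_nonneg _
  have h0' : 0 ≤ ‖permFun g.1 x‖ := norm_nonneg _
  nlinarith

/-! ### The goal at a leaf -/

/-- The assigned tables DESCRIBE their pivots (and carry the right type). [folklore] -/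
def AssignedOK {ι : Type*} (cen : List IVec) (pos : ι → EuclideanSpace ℝ (Fin 3)) (W : IVec → PivotW ι)
    (assigned : List Assigned) : Prop :=
  ∀ a ∈ assigned, a.1 ∈ cen ∧ a.2.1 = (W a.1).t ∧ TableDescribes pos (W a.1) a.2.2

/-- **The leaf goal**: a valid context whose bridge clauses hold, and a full assignment of described tables passing the
leaf checks. [folklore] -/
def LeafGoal {ι : Type*} (cen : List IVec) (pos : ι → EuclideanSpace ℝ (Fin 3)) (W : IVec → PivotW ι) : Prop :=
  ∃ (κ : Ctx) (assigned : List Assigned) (wits : List (List (ℤ × ℤ × ℤ))) (witI : List (ℤ × ℤ × ℤ)),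
    ctxValid κ = true ∧ bridgeOK cen κ witI = true ∧ wits.length = assigned.length ∧
    (List.zip assigned wits).all (fun aw => leafTableOK κ aw.1.1 aw.1.2.2 aw.2) = true ∧
    AssignedOK cen pos W assigned ∧ ∀ v ∈ cen, ∃ a ∈ assigned, a.1 = v

end Literature.Geometry.DiscreteGeometry.TwoShellChart

end
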